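import Mathlib
import HarnessLib
import Summits.Ventures.LatticeQCDFlow.Exactness.SphereDriftLift
import Summits.Ventures.LatticeQCDFlow.Exactness.SphereAxisDisintegration

/-!
# The exponential chart of the sphere dominates: surface measure of `S^{n+1}` ≤ `t^{n+1}` × (Lebesgue on the tangent ball of radius `π/t` pushed through the time-`t` geodesic endpoint map)

HONEST FRAMING: exact (Metropolis-corrected) sampling algorithms for lattice gauge theory;
figures of merit are autocorrelation/cost numbers at stated couplings and volumes; no
continuum-physics claim.

Venture `LatticeQCDFlow` (cell pub-lqcd), topic `Exactness`, FANOUT row 9 (eng-latcore, the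
engine `latflow.core.cpn_2d.HMCCPN._geodesic`: `z ← cos(ε|π|) z + sin(ε|π|) π/|π|`).  NEW WORK of
the cell over Mathlib (`Measure.toSphere`, `Measure.volumeIoiPow`, `Real.map_volume_mul_right`,
`lintegral_map_equiv`) and the tree: row 7's `SphereDriftLift.lean` / `SphereFrameLift.lean`
(`ambientDrift`, `tangentialPart`, `frameMap_driftLift` — the drift is the shadow of a right
translation of `SO(d)`), `SphereOrbitLaw.lean` (`actSO`, `actSO_mul`), row 7's
`SphereAxisCoordinates.lean` / `SphereAxisDisintegration.lean` (`polarAxis`, `equatorEmbed`,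
`axisCoords`, `latitudePt`, **`lintegral_toSphere_eq_lintegral_latitude`**: `dσ_{S^{n+1}} =
sin^n θ dθ dσ_{S^n}`) and `RadialPolar.lean` (`dirSphere`, `lintegral_dirSphere_norm`: polar
coordinates).  Nothing is cited as a fact.  Printed counterpart, NAMED ONLY: the comparison
`sin θ ≤ θ` is the `K = 1` case of Bishop's volume comparison (e.g. Chavel, *Riemannian Geometry*,
Thm III.4.3); Engel–Schaefer, Comput. Phys. Commun. 182 (2011) 2107, eq. (11).

Part 2a of the gen-16 chain (CP(N−1)/sphere HMC ergodicity).  The ONE geometric input the Doeblin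
argument needs — the analogue, for spheres, of `U1ExpChartMinorisation.lean` (gen-13) and
`SUNExpChartMinorisation.lean` (gen-15): Lebesgue measure on a tangent ball, pushed through the
exponential map, dominates a multiple of the uniform measure.  On the sphere the chart of radius
`π` covers everything but the antipode, so ONE step will do (no covering lemma, unlike SU(N)).

## Content (`m` finite; `E = ℝ^m`, `S = S^{m−1}`; then `m = Fin (n+2)`, equator `ℝ^{n+1}`)

* §1 `spherePos t x q := (ambientDrift t (x, q)).1` — the position reached in time `t` from `x`
  with ambient momentum `q` (the geodesic endpoint `Exp_x(t · π)`, `π` the tangential part of `q`);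
  `coe_spherePos`, `measurable_spherePos`; `rotSO_one`, `actSO_one`, `spherePos_eq_actSO_bodyRot`;
  **`spherePos_actSO`** — ROTATION EQUIVARIANCE `spherePos t (O x) (O q) = O (spherePos t x q)`.
* §2 at the pole `polarAxisPt n = e₀`: `tangentialPart_polarAxisPt` (`= (0, y)`, `y` the
  equatorial coordinates of `q`), `expBall n t y := latitudePt n (‖y‖ t) (dirSphere y)` — the
  exponential map at `e₀` in equatorial coordinates, `measurable_expBall`;
  **`spherePos_polarAxisPt`** — `spherePos t e₀ q = expBall n t (axisCoords n q).2`.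
* §3 `lintegral_comp_mul_right_Ioo` (the substitution `u = r t` on `(0, π)`), the inner radial
  comparison `setLIntegral_sin_pow_le`, and **`lintegral_toSphere_le_expBall`**: for measurable
  `G ≥ 0` and `t > 0`, `∫ G dσ_{n+2} ≤ t^{n+1} ∫_{‖y‖ < π/t} G(expBall n t y) dy`; as measures
  **`toSphere_le_smul_map_expBall`**: `σ_{n+2} ≤ t^{n+1} • (Lebesgue|_{ball 0 (π/t)}).map (expBall n t)`.
  Proof: both sides in (direction, radius)/(equator point, polar angle) coordinates; the flat side
  carries `r^n dr`, the round side `sin^n θ dθ`, and `sin θ ≤ θ` on `[0, π]`.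

NOT CLAIMED: equality (the Jacobian `(sin θ/θ)^n` itself), anything at the antipode, general axes
(part 2b rotates), rates.
-/

noncomputable section

namespace Summit.Ventures.LatticeQCDFlow.Exactness

open MeasureTheory Measure Metric Set Real
open scoped ENNReal InnerProductSpace

/-! ## §1 The geodesic endpoint map and its rotation equivariance -/

section General

variable {m : Type*} [Fintype m] [DecidableEq m]

/-- **The geodesic endpoint**: the position reached in time `t` from `x ∈ S^{d−1}` with ambient
momentum `q` (E–S eq. (11) applied to the tangential part of `q`; the engine's `_geodesic`). -/
def spherePos (t : ℝ) (x : sphere (0 : EuclideanSpace ℝ m) 1) (q : EuclideanSpace ℝ m) :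
    sphere (0 : EuclideanSpace ℝ m) 1 :=
  (ambientDrift t (x, q)).1

omit [DecidableEq m] in
/-- Coordinates of the endpoint: `cos(‖π‖t) x + (sin(‖π‖t)/‖π‖) π`, `π` the tangential part. -/
theorem coe_spherePos (t : ℝ) (x : sphere (0 : EuclideanSpace ℝ m) 1) (q : EuclideanSpace ℝ m) :
    (spherePos t x q : EuclideanSpace ℝ m) =
      Real.cos (‖tangentialPart (x, q)‖ * t) • (x : EuclideanSpace ℝ m) +
        (Real.sin (‖tangentialPart (x, q)‖ * t) / ‖tangentialPart (x, q)‖) • tangentialPart (x, q) :=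
  rfl

omit [DecidableEq m] in
/-- The endpoint is jointly measurable in (position, momentum). -/
theorem measurable_spherePos (t : ℝ) :
    Measurable fun z : sphere (0 : EuclideanSpace ℝ m) 1 × EuclideanSpace ℝ m => spherePos t z.1 z.2 :=
  measurable_fst.comp (measurable_ambientDrift t)

omit [DecidableEq m] in
/-- The endpoint is measurable in the momentum. -/
theorem measurable_spherePos_right (t : ℝ) (x : sphere (0 : EuclideanSpace ℝ m) 1) :
    Measurable (spherePos t x) := by
  have h : spherePos t x =
      (fun z : sphere (0 : EuclideanSpace ℝ m) 1 × EuclideanSpace ℝ m => spherePos t z.1 z.2) ∘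
        fun q => (x, q) := rfl
  rw [h]
  exact (measurable_spherePos t).comp (measurable_const.prodMk measurable_id)

/-- The identity of `SO(d)` acts trivially on vectors … -/
theorem rotSO_one (q : EuclideanSpace ℝ m) : rotSO (1 : Matrix.specialOrthogonalGroup m ℝ) q = q := by
  rw [rotSO_apply]
  simp

/-- … and on the sphere. -/
theorem actSO_one (s : sphere (0 : EuclideanSpace ℝ m) 1) :
    actSO (1 : Matrix.specialOrthogonalGroup m ℝ) s = s :=
  Subtype.ext (by rw [coe_actSO_eq_rotSO, rotSO_one])

/-- The endpoint is the start rotated by the body rotation of row 7's frame lift. -/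
theorem spherePos_eq_actSO_bodyRot (t : ℝ) (x : sphere (0 : EuclideanSpace ℝ m) 1) (q : EuclideanSpace ℝ m) :
    spherePos t x q = actSO (bodyRot t x q) x := by
  have h0 := congrArg Prod.fst (frameMap_driftLift t x (1, q))
  simp only [frameMap, driftLift, one_mul, actSO_one, rotSO_one] at h0
  exact h0.symm

/-- **Rotation equivariance of the geodesic endpoint**: `spherePos t (O x) (O q) = O (spherePos t x q)`
for every `O ∈ SO(d)`. -/
theorem spherePos_actSO (t : ℝ) (O : Matrix.specialOrthogonalGroup m ℝ) (x : sphere (0 : EuclideanSpace ℝ m) 1)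
    (q : EuclideanSpace ℝ m) :
    spherePos t (actSO O x) (rotSO O q) = actSO O (spherePos t x q) := by
  have h1 := congrArg Prod.fst (frameMap_driftLift t x (O, q))
  simp only [frameMap, driftLift] at h1
  rw [spherePos_eq_actSO_bodyRot t x q, ← actSO_mul]
  exact h1.symm

/-- The endpoint with a shifted, rotated momentum: `spherePos t (O x) (O q + w) = O (spherePos t x (q + O⁻¹ w))`. -/
theorem spherePos_actSO_add (t : ℝ) (O : Matrix.specialOrthogonalGroup m ℝ) (x : sphere (0 : EuclideanSpace ℝ m) 1)
    (q w : EuclideanSpace ℝ m) :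
    spherePos t (actSO O x) (rotSO O q + w) = actSO O (spherePos t x (q + (rotSO O).symm w)) := by
  rw [← spherePos_actSO, map_add, LinearIsometryEquiv.apply_symm_apply]

end General

/-! ## §2 At the pole: the endpoint in equatorial coordinates -/

section Pole

variable (n : ℕ)

/-- The pole `e₀` as a point of the sphere `S^{n+1}`. -/
def polarAxisPt : sphere (0 : EuclideanSpace ℝ (Fin (n + 2))) 1 :=
  ⟨polarAxis n, by rw [mem_sphere_zero_iff_norm, norm_polarAxis]⟩

/-- Coordinates of the pole. -/
@[simp] theorem coe_polarAxisPt : (polarAxisPt n : EuclideanSpace ℝ (Fin (n + 2))) = polarAxis n := rfl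

/-- A vector is its axis coordinate times `e₀` plus its equatorial part. -/
theorem eq_axis_add_equator (q : EuclideanSpace ℝ (Fin (n + 2))) :
    q = (axisCoords n q).1 • polarAxis n + equatorEmbed n (axisCoords n q).2 := by
  conv_lhs => rw [← (axisCoords n).symm_apply_apply q]
  exact axisCoords_symm_apply_eq n _ _

/-- `⟪e₀, q⟫` is the axis coordinate. -/
theorem inner_polarAxis_eq_fst (q : EuclideanSpace ℝ (Fin (n + 2))) :
    ⟪polarAxis n, q⟫_ℝ = (axisCoords n q).1 := by
  conv_lhs => rw [eq_axis_add_equator n q]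
  rw [inner_add_right, real_inner_smul_right, real_inner_self_eq_norm_sq, norm_polarAxis,
    inner_polarAxis_equatorEmbed]
  ring

/-- **At the pole the tangential part of `q` is its equatorial part** `(0, y)`. -/
theorem tangentialPart_polarAxisPt (q : EuclideanSpace ℝ (Fin (n + 2))) :
    tangentialPart (polarAxisPt n, q) = equatorEmbed n (axisCoords n q).2 := by
  unfold tangentialPart
  change q - ⟪polarAxis n, q⟫_ℝ • polarAxis n = _
  rw [inner_polarAxis_eq_fst]
  nth_rewrite 1 [eq_axis_add_equator n q]
  abel

/-- **The exponential map at the pole in equatorial coordinates, time `t`**: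
`y ↦ latitudePt (‖y‖ t) (y/‖y‖)` (`= e₀` for `y = 0`). -/
def expBall (t : ℝ) (y : EuclideanSpace ℝ (Fin (n + 1))) : sphere (0 : EuclideanSpace ℝ (Fin (n + 2))) 1 :=
  latitudePt n (‖y‖ * t) (dirSphere y)

/-- `expBall n t` is measurable. -/
theorem measurable_expBall (t : ℝ) : Measurable (expBall n t) := by
  have h : expBall n t =
      (fun p : ℝ × sphere (0 : EuclideanSpace ℝ (Fin (n + 1))) 1 => latitudePt n p.1 p.2) ∘
        fun y => (‖y‖ * t, dirSphere y) := rfl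
  rw [h]
  exact (measurable_latitudePt n).comp ((measurable_norm.mul_const t).prodMk measurable_dirSphere)

/-- **At the pole the geodesic endpoint is the exponential map of the equatorial coordinates**:
`spherePos t e₀ q = expBall n t (axisCoords n q).2`. -/
theorem spherePos_polarAxisPt (t : ℝ) (q : EuclideanSpace ℝ (Fin (n + 2))) :
    spherePos t (polarAxisPt n) q = expBall n t (axisCoords n q).2 := by
  apply Subtype.ext
  rw [coe_spherePos, tangentialPart_polarAxisPt, norm_equatorEmbed, expBall, coe_latitudePt,
    coe_polarAxisPt]
  by_cases hy : (axisCoords n q).2 = 0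
  · simp [hy]
  · rw [dirSphere_coe hy, map_smul, smul_smul, div_eq_mul_inv]

end Pole

/-! ## §3 The chart comparison: `σ_{n+2} ≤ t^{n+1} • (Lebesgue|_{‖y‖<π/t}).map (expBall n t)` -/

section Chart

variable (n : ℕ)

/-- The substitution `u = r t` for a function supported in `(0, π)`:
`∫_{(0,π)} k = t · ∫_r 1_{(0,π)}(r t) k(r t) dr` (`t > 0`). -/
theorem lintegral_Ioo_eq_mul_lintegral_comp_mul {t : ℝ} (ht : 0 < t) (k : ℝ → ℝ≥0∞) :
    ∫⁻ u, (Ioo 0 π).indicator k u = ENNReal.ofReal t * ∫⁻ r, (Ioo 0 π).indicator k (r * t) := by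
  have ht0 : t⁻¹ ≠ 0 := inv_ne_zero ht.ne'
  have h := lintegral_map_equiv (μ := (volume : Measure ℝ)) (fun r => (Ioo 0 π).indicator k (r * t))
    (Homeomorph.mulRight₀ t⁻¹ ht0).toMeasurableEquiv
  rw [Homeomorph.toMeasurableEquiv_coe, Homeomorph.coe_mulRight₀, Real.map_volume_mul_right ht0,
    lintegral_smul_measure, smul_eq_mul, inv_inv, abs_of_pos ht] at h
  simp_rw [inv_mul_cancel_right₀ ht.ne'] at h
  exact h.symm

/-- **The radial comparison after substitution**: for `g ≥ 0` on `(0, π)` and `t > 0`,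
`∫_{(0,π)} g(u) sin^n u du ≤ t^{n+1} ∫_{(0,π/t)} g(r t) r^n dr` (`sin u ≤ u`, then `u = r t`). -/
theorem setLIntegral_sin_pow_le {t : ℝ} (ht : 0 < t) (g : ℝ → ℝ≥0∞) :
    ∫⁻ u in Ioo 0 π, g u * ENNReal.ofReal (Real.sin u ^ n) ≤
      ENNReal.ofReal (t ^ (n + 1)) * ∫⁻ r in Ioo 0 (π / t), g (r * t) * ENNReal.ofReal (r ^ n) := by
  -- `sin u ≤ u` on `(0, π)`
  have h1 : ∫⁻ u in Ioo 0 π, g u * ENNReal.ofReal (Real.sin u ^ n) ≤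
      ∫⁻ u in Ioo 0 π, g u * ENNReal.ofReal (u ^ n) := by
    refine setLIntegral_mono' measurableSet_Ioo fun u hu => ?_
    gcongr
    · exact Real.sin_nonneg_of_nonneg_of_le_pi hu.1.le hu.2.le
    · exact Real.sin_le hu.1.le
  refine h1.trans (le_of_eq ?_)
  -- the substitution `u = r t`
  rw [← lintegral_indicator measurableSet_Ioo, ← lintegral_indicator measurableSet_Ioo,
    lintegral_Ioo_eq_mul_lintegral_comp_mul ht, pow_succ, ENNReal.ofReal_mul (pow_nonneg ht.le n),
    mul_comm (ENNReal.ofReal (t ^ n)), mul_assoc]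
  congr 1
  rw [← lintegral_const_mul' _ _ ENNReal.ofReal_ne_top]
  refine lintegral_congr fun r => ?_
  by_cases hr : r ∈ Ioo 0 (π / t)
  · have hrt : r * t ∈ Ioo 0 π := ⟨mul_pos hr.1 ht, (lt_div_iff₀ ht).1 hr.2⟩
    rw [indicator_of_mem hrt, indicator_of_mem hr, mul_pow, ENNReal.ofReal_mul (pow_nonneg hr.1.le n)]
    ring
  · have hrt : r * t ∉ Ioo 0 π := fun h => hr ⟨pos_of_mul_pos_left h.1 ht.le, (lt_div_iff₀ ht).2 h.2⟩
    rw [indicator_of_notMem hrt, indicator_of_notMem hr, mul_zero]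

/-- **THE CHART COMPARISON (integral form).**  For measurable `G ≥ 0` on `S^{n+1}` and `t > 0`:
`∫ G dσ_{n+2} ≤ t^{n+1} · ∫_{‖y‖ < π/t} G (expBall n t y) dy` — the surface measure is dominated by
`t^{n+1}` times Lebesgue measure on the tangent ball of radius `π/t` pushed through the time-`t`
exponential map at the pole.  (Latitude disintegration on the round side, polar coordinates on the
flat side, `sin θ ≤ θ` in between.) -/
theorem lintegral_toSphere_le_expBall {t : ℝ} (ht : 0 < t)
    {G : sphere (0 : EuclideanSpace ℝ (Fin (n + 2))) 1 → ℝ≥0∞} (hG : Measurable G) :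
    ∫⁻ x, G x ∂(volume : Measure (EuclideanSpace ℝ (Fin (n + 2)))).toSphere ≤
      ENNReal.ofReal (t ^ (n + 1)) *
        ∫⁻ y in ball (0 : EuclideanSpace ℝ (Fin (n + 1))) (π / t), G (expBall n t y) ∂volume := by
  -- the round side in latitude coordinates
  rw [lintegral_toSphere_eq_lintegral_latitude n hG]
  -- the flat side in polar coordinates: the integrand as a function of (direction, radius)
  set F : sphere (0 : EuclideanSpace ℝ (Fin (n + 1))) 1 × ℝ → ℝ≥0∞ :=
    (Prod.snd ⁻¹' Iio (π / t)).indicator fun p => G (latitudePt n (p.2 * t) p.1) with hF_def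
  have hF : Measurable F :=
    (hG.comp ((measurable_latitudePt n).comp ((measurable_snd.mul_const t).prodMk measurable_fst))).indicator
      (measurable_snd measurableSet_Iio)
  have hflat : ∫⁻ y in ball (0 : EuclideanSpace ℝ (Fin (n + 1))) (π / t), G (expBall n t y) ∂volume =
      ∫⁻ y, F (dirSphere y, ‖y‖) ∂volume := by
    rw [← lintegral_indicator measurableSet_ball]
    refine lintegral_congr fun y => ?_
    by_cases hy : y ∈ ball (0 : EuclideanSpace ℝ (Fin (n + 1))) (π / t)
    · have hy' : ((dirSphere y, ‖y‖) : sphere (0 : EuclideanSpace ℝ (Fin (n + 1))) 1 × ℝ) ∈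
          Prod.snd ⁻¹' Iio (π / t) := by simpa using hy
      rw [indicator_of_mem hy, hF_def, indicator_of_mem hy']
      rfl
    · have hy' : ((dirSphere y, ‖y‖) : sphere (0 : EuclideanSpace ℝ (Fin (n + 1))) 1 × ℝ) ∉
          Prod.snd ⁻¹' Iio (π / t) := by simpa using hy
      rw [indicator_of_notMem hy, hF_def, indicator_of_notMem hy']
  have hF2 : Measurable fun p : sphere (0 : EuclideanSpace ℝ (Fin (n + 1))) 1 × Ioi (0 : ℝ) =>
      F (p.1, (p.2 : ℝ)) :=
    hF.comp (measurable_fst.prodMk (measurable_subtype_coe.comp measurable_snd))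
  rw [hflat, lintegral_dirSphere_norm volume hF, finrank_euclideanSpace_fin,
    show n + 1 - 1 = n by omega,
    lintegral_prod (fun p : sphere (0 : EuclideanSpace ℝ (Fin (n + 1))) 1 × Ioi (0 : ℝ) =>
      F (p.1, (p.2 : ℝ))) hF2.aemeasurable]
  -- the inner radial integral against `r^n dr` on `(0, ∞)`
  have hinner : ∀ s : sphere (0 : EuclideanSpace ℝ (Fin (n + 1))) 1,
      ∫⁻ r, F (s, (r : ℝ)) ∂(Measure.volumeIoiPow n) =
        ∫⁻ r in Ioo 0 (π / t), G (latitudePt n (r * t) s) * ENNReal.ofReal (r ^ n) := by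
    intro s
    have hFs : Measurable fun r : ℝ => F (s, r) := hF.comp (measurable_const.prodMk measurable_id)
    have hFs' : Measurable fun r : Ioi (0 : ℝ) => F (s, (r : ℝ)) := hFs.comp measurable_subtype_coe
    rw [Measure.volumeIoiPow, lintegral_withDensity_eq_lintegral_mul _
      ((measurable_subtype_coe.pow_const n).ennreal_ofReal) hFs']
    have hsub := lintegral_subtype_comap (μ := (volume : Measure ℝ)) (measurableSet_Ioi (a := (0 : ℝ)))
      (fun u : ℝ => ENNReal.ofReal (u ^ n) * F (s, u))
    refine (Eq.trans (lintegral_congr fun r => rfl) hsub).trans ?_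
    rw [← lintegral_indicator measurableSet_Ioi, ← lintegral_indicator measurableSet_Ioo]
    refine lintegral_congr fun r => ?_
    by_cases h0 : 0 < r
    · by_cases h1 : r < π / t
      · have hr : ((s, r) : sphere (0 : EuclideanSpace ℝ (Fin (n + 1))) 1 × ℝ) ∈ Prod.snd ⁻¹' Iio (π / t) := h1
        rw [indicator_of_mem (show r ∈ Ioi (0 : ℝ) from h0), indicator_of_mem (show r ∈ Ioo 0 (π / t) from ⟨h0, h1⟩),
          hF_def, indicator_of_mem hr, mul_comm]
      · have hr : ((s, r) : sphere (0 : EuclideanSpace ℝ (Fin (n + 1))) 1 × ℝ) ∉ Prod.snd ⁻¹' Iio (π / t) := h1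
        rw [indicator_of_mem (show r ∈ Ioi (0 : ℝ) from h0),
          indicator_of_notMem (show r ∉ Ioo 0 (π / t) from fun h => h1 h.2), hF_def,
          indicator_of_notMem hr, mul_zero]
    · rw [indicator_of_notMem (show r ∉ Ioi (0 : ℝ) from h0),
        indicator_of_notMem (show r ∉ Ioo 0 (π / t) from fun h => h0 h.1)]
  simp_rw [hinner]
  -- compare the inner integrals and pull the constant out
  rw [← lintegral_const_mul' _ _ ENNReal.ofReal_ne_top]
  refine lintegral_mono fun s => ?_
  exact setLIntegral_sin_pow_le n ht fun u => G (latitudePt n u s)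

/-- **THE CHART COMPARISON (measure form)**: `σ_{n+2} ≤ t^{n+1} • (Lebesgue|_{ball 0 (π/t)}).map (expBall n t)`. -/
theorem toSphere_le_smul_map_expBall {t : ℝ} (ht : 0 < t) :
    (volume : Measure (EuclideanSpace ℝ (Fin (n + 2)))).toSphere ≤
      ENNReal.ofReal (t ^ (n + 1)) •
        ((volume : Measure (EuclideanSpace ℝ (Fin (n + 1)))).restrict (ball 0 (π / t))).map (expBall n t) := by
  refine Measure.le_iff.2 fun A hA => ?_
  have hind : Measurable (A.indicator (1 : sphere (0 : EuclideanSpace ℝ (Fin (n + 2))) 1 → ℝ≥0∞)) :=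
    measurable_one.indicator hA
  rw [← lintegral_indicator_one hA, Measure.smul_apply, smul_eq_mul,
    Measure.map_apply (measurable_expBall n t) hA, ← lintegral_indicator_one ((measurable_expBall n t) hA)]
  refine (lintegral_toSphere_le_expBall n ht hind).trans (le_of_eq ?_)
  congr 1

end Chart

end Summit.Ventures.LatticeQCDFlow.Exactness

end
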